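import Summits.Ventures.CertifiedArithmetic.LowPrec.GemmThetaLawGenMixCData

/-!
# E3M2×E2M3 law check, part 14/14: `bin 13` (sign −), `bin 14` (sign +), `bin 14` (sign −)

HONEST FRAMING (venture CertifiedArithmetic / cell `pub-lowprec`, seat gemm, gen 13): certified
error envelopes and provably optimal rounding/accumulation schemes for low-precision formats under
stated cost models; every table by two implementations; no hardware or vendor claims.

Part 14/14 of the per-level kernel check of `e3m2e2m3Law.lawCheck` (see
`GemmThetaLawGenMixCData.lean`): `bin 13` (sign −), `bin 14` (sign +), `bin 14` (sign −) (1226 +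
1202 + 1202 classes; a level above 2400 classes is split by sign, the two halves are joined in
`GemmThetaLawGenMixC.lean`). [cell]
-/

namespace Literature.ComputerArithmetic.FloatingPoint

namespace MiniFloat

namespace ThetaLaw

/-- Level `bin 13`, sign `−`, of the E3M2×E2M3 law check: all classes pass and cover (1226 of the
level's 2452 classes, all 481 letters). [cell, kernel `decide`] -/
theorem levCheck_e3m2e2m3_b13_neg :
    (e3m2e2m3Law.lam.all fun q =>
      (e3m2e2m3Law.mainClasses (Lev.bin 13) (-1) q).all e3m2e2m3Law.clsOK &&
        e3m2e2m3Law.coverOK (Lev.bin 13) (-1) q) = true := by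
  decide +kernel

/-- Level `bin 14`, sign `+`, of the E3M2×E2M3 law check: all classes pass and cover (1202 of the
level's 2404 classes, all 481 letters). [cell, kernel `decide`] -/
theorem levCheck_e3m2e2m3_b14_pos :
    (e3m2e2m3Law.lam.all fun q =>
      (e3m2e2m3Law.mainClasses (Lev.bin 14) 1 q).all e3m2e2m3Law.clsOK &&
        e3m2e2m3Law.coverOK (Lev.bin 14) 1 q) = true := by
  decide +kernel

/-- Level `bin 14`, sign `−`, of the E3M2×E2M3 law check: all classes pass and cover (1202 of the
level's 2404 classes, all 481 letters). [cell, kernel `decide`] -/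
theorem levCheck_e3m2e2m3_b14_neg :
    (e3m2e2m3Law.lam.all fun q =>
      (e3m2e2m3Law.mainClasses (Lev.bin 14) (-1) q).all e3m2e2m3Law.clsOK &&
        e3m2e2m3Law.coverOK (Lev.bin 14) (-1) q) = true := by
  decide +kernel

end ThetaLaw

end MiniFloat

end Literature.ComputerArithmetic.FloatingPoint
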